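import Literature.MathematicalPhysics.QuantumFieldTheory.Balaban1983to89.B4Cor23ZeroEta
import Literature.MathematicalPhysics.QuantumFieldTheory.Balaban1983to89.B4Cor23RegionDelta

/-!
# B4 Corollary 2.3 at `A ≠ 0` — the typed statement `B4.Cor23Printed` on the family of regular-field region pairs

T. Bałaban, *Regularity and decay of lattice Green's functions*, Commun. Math. Phys. **89** (1983) 571–597 (= B4),
pp. 580–581, Corollary 2.3 (PRINTED, transcript `HOME/b2b-balaban-b04/transcript-B4.md` ll.135–152):
«If Ω and A are as in Proposition I.2.1, then there exist positive constants c₀, δ₀ such that for arbitrary scalar field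
configurations f, f' defined on Ω, we have» «(2.30) |⟨f, G_k(Ω,A)f'⟩|, |⟨f, D^η_{A,μ}G_k(Ω,A)f'⟩|,
|⟨f, G_k(Ω,A)D^{η*}_{A,ν}f'⟩|, |⟨f, D^η_{A,μ}G_k(Ω,A)D^{η*}_{A,ν}f'⟩| ≤ c₀e^{−δ₀dist(supp f, supp f')}‖f‖₂‖f'‖₂.»
«The same inequalities hold for δG_k(Ω,Ω₀,A) with the additional factor e^{−δ₀(dist(supp f,Ω^c) + dist(supp f',Ω^c))}.»
The standing hypotheses «as in Proposition I.2.1» are those of p. 572–573: «We consider subsets Ω which are unions of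
big blocks.» and the regularity (1.7) «|(∂^η_μ A)(x)| ≤ c e^{β−1}, x ∈ Ω, μ = 1,…,d, β > 0», «for e sufficiently small».

`B4.Cor23Printed (fam : I → EtaSetting)` (module `B4`) is the typed form of this Corollary over an ABSTRACT family of
η-lattice instances — `∃ c₀ δ₀ e₁ > 0, ∀ i, regular → bigBlocks → 0 < e → e ≤ e₁ → (the four `G` inequalities) ∧ (the
four `δG` inequalities)`.  The zero-field family was discharged in `B4Cor23ZeroEta`.  THIS MODULE builds the CONCRETE
FAMILY OF REGULAR-FIELD REGION PAIRS (every non-zero vector field) and proves `Cor23Printed` for it from the two kernel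
theorems `B4Cor23Region.cor23_main_region` ((2.30), the `G_k(Ω,A)` clause at `A ≠ 0`, cell node 5) and
`B4Cor23RegionDelta.dcor23_main_region` (the `δG_k(Ω,Ω₀,A)` clause at `A ≠ 0`, cell node 6b):

* `RegularPairInstance d` — one instance = a `B4Lemma21Region.RegularCubeInstance` (mesh `η = 1/n`, `n ≥ 1`; the unit
  labels `Ωc` of `Ω`; the charge `e`; the vector field `A_ν(x)` in component form on the whole fine lattice; the mass
  `m² ≥ 0`) TOGETHER WITH the unit labels `Ω₀c ⊇ Ωc` of the ambient region `Ω₀ ⊇ Ω` of (1.11); NO further hypothesis.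
  The family is indexed by ALL such instances, for fixed `d`, a fixed orthogonal flow `F` (`U(A) = F.U((e/n)·A)`), and
  fixed constants `a > 0` (of `aP_k`), `c ≥ 0`, `β > 0` (of (1.7)) and a big-block size `M`;
* `regularPairSettingB F a c β M g i : B4.EtaSetting` — the carrier of instance `i`: `Site = Ω` (fine points),
  `Dir = Fin (d+1)`, `Src = (Ω × ι → ℝ)` (`R^N`-valued configurations on `Ω`); `pair k`, `dpair k` (`k = 0,…,3`) = the
  four pairings of `G = G_k(Ω,A) = (B4Lemma21Region.regionOp F e hn a m² Ωc A)⁻¹` with `D^η_{A,μ} =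
  B4Lemma21Region.regionDeriv` (`D^{η*}` = transpose) and of `δG = G − res ∘ G₀ ∘ ext` (`B4Cor23RegionDeltaAlg.dGv`,
  (1.11) read on configurations on `Ω`) in the printed order (`pairR` / `dpairR`); `ssdist = B4Cor23Region.bsuppDist`
  (η-scaled sup-distance of the site supports), `l2Norm = bl2n` (counting `ℓ²`), `bdistS f = g i f` for a
  boundary-distance assignment `g` (ADMISSIBLE below); `e = i.e`; the printed hypotheses as FAITHFUL predicates:
  `regular` = (1.7) in lattice units `|A_ν(x + e_μ) − A_ν(x)| ≤ c e^{β−1}/n` for `x ∈ Ω₀` (the field must be regular on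
  the AMBIENT region, on which `G_k(Ω₀,A)` of (1.11) lives; instances with `Ω₀ = Ω` carry exactly the printed hypothesis
  of the `G_k(Ω,A)` clause), `bigBlocks` = `Ω` and `Ω₀` are unions of `M`-blocks (`IsBlockUnion (M·n)` of the fine point
  sets — carried, NOT USED: the certificate holds for every nested pair of finite unions of unit blocks); the fields not
  read by `Cor23Printed` are filled as DEFINITIONS ONLY: `pdist = edistR`, `sdist1/2`, `bdist1/2` set distances as in
  `B4Cor23ZeroEta` (`bdist1/2` to the fine points of `Ω₀∖Ω`), `supNorm f = sup_x |f(x)|` (Euclidean site norm),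
  `valG/valDG/dvalG/dvalDG` the site norms of `Gf`, `D_μGf`, `δGf`, `D_μδGf`, `lower18 γ` = `γ‖Φ‖² ≤ ⟨Φ, H_k(Ω,A)|_{m²=0}Φ⟩`,
  `rect` = `Ω` is a box; the HÖLDER QUOTIENTS `lhs19`, `dlhs19` of (1.9) (which need the parallel transporters
  `U(A(Γ_{x,x'}))` along the contours `Γ_{x,x'}`, not modelled in this package at `A ≠ 0`) are NOT MODELLED and set to
  `0` — `B4.ThmPrinted` / `Ineq19_110` / `Ineq111_112` MUST NOT be read on this carrier (same convention as
  `B4Lemma21Region.regularCube.holder1`, `B4Lower18RegularRegion.regularRegionSetting`);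
* ADMISSIBLE `g`: whenever `Ω₀∖Ω` and `supp f` are nonempty, `g i f ≤ bdistV f = dist_η(supp f, Ω₀∖Ω)`
  (`B4Cor23RegionDelta.bdistV`, measured to the fine points of `Ω₀∖Ω` on the fine lattice of `Ω₀`).  The printed
  `dist(supp f, Ω^c)` — complement in the ambient η-lattice — is admissible since `Ω₀∖Ω ⊆ Ω^c`, and so is `bdistV`
  (the default carrier `regularPairSetting`); in the degenerate cases (`Ω₀ = Ω`, or `f = 0`, or `f' = 0`) the `δG`
  pairings vanish (`dpairR_eq_zero_of_eq/_left/_right`), so no condition is needed there;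
* `cor23Printed_regularPairB`: for a flow with `‖(U(t) − 1)v‖² ≤ (ℓt)²‖v‖²`, `a > 0`, `c ≥ 0`, `β > 0`, every `M` and
  every admissible `g`, `Cor23Printed (regularPairSettingB F a c β M g)` with the witnesses
  `c₀ = max(c0R a, c1R d a)`, `δ₀ = delta0R d a / 2` and the threshold `e₁(ℓ, d, c, β, a)` of
  `B4Lower18Regular.threshold_exists` (chosen BEFORE the instance); `cor23Printed_regularPair` (default `g`);
  `cor23Printed_regularPair_rot` (the rotation flow, `N = 2`, `ℓ = 1`: every flow hypothesis discharged);
* NON-VACUITY (`linPairInst_meets`, `threshold_met`): for EVERY threshold `e₁ > 0`, every `M ≥ 1`, every mesh and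
  every mass, the instance `Ω = [0,M)^{d+1} ⊊ Ω₀ = [0,2M)^{d+1}` (unit labels) with the NON-CONSTANT field
  `A_ν(x) = λx_0`, `λ = c e₁^{β−1}/n`, and charge `e₁` meets every antecedent (`regular` on `Ω₀`, `bigBlocks`,
  `0 < e ≤ e₁`) and is non-degenerate (`Ω₀∖Ω` has fine points, `Ω ≠ ∅`): the threshold excludes no scale, region or
  mass, and the conclusion is asserted for genuinely non-zero fields and genuinely nested pairs.  (At `A ≠ 0` the charge
  enters the operators `U(A) = F.U((e/n)A)`, so no analogue of the zero-field equivalence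
  `B4Cor23ZeroEta.cor23Printed_zeroFieldB_iff_free` (typed ⟺ threshold-free) is asserted here.)

## HONEST SCOPE

* Exactly the content of `cor23_main_region` and `dcor23_main_region`, re-packaged: finite nested unions `Ω ⊆ Ω₀` of
  unit blocks (no torus, no infinite `Ω₀`; the big-block antecedent is carried, not used); `R^N`-valued `f, f'`;
  counting `ℓ²` norms and pairings (both sides of (2.30) scale by the same `η^{d+1}`); sup-distances in η-units; the
  `D^η_{A,μ}` outside `δG` is the one of `Ω` ((1.3), Neumann convention); (1.7) demanded on `Ω₀`.
* RATE: `δ₀ = delta0R d a / 2` in BOTH factors (the `G` clause holds with `delta0R`, weakened here to a common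
  witness; the `δG` clause is certified at half the rate of the tree's (2.30) clause — DIVERGENCE D-b04g14-3; the
  printed constants are existential, so nothing printed is contradicted).
* `B4.Cor23Printed` is not a conjunct of the DAG leaf `B4.LeafB4`; this module discharges the typed Corollary on the
  regular-field family and nothing of `LeafB4`.  `lhs19`/`dlhs19` are placeholders (see above).
* No step of the paper is used as a hypothesis; no cited fact; the paper gives no proof of Corollary 2.3 beyond «the
  proof proceeds as before using only the L²-bounds of Lemma 2.1» — the tree's proof (Combes–Thomas boosts, cell nodes
  4–6) is its own.

Value = kernel certificate of a published lemma-level statement (typed form, every non-zero regular field on finite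
block unions), NOT summit progress.
-/

namespace Literature.MathematicalPhysics.QuantumFieldTheory.Balaban1983to89.B4Cor23RegionEta

open Finset Matrix
open Literature.MathematicalPhysics.QuantumFieldTheory.Balaban1983to89.B4 (EtaSetting Cor23Printed)
open Literature.MathematicalPhysics.QuantumFieldTheory.Balaban1983to89.B4GaugeCovariance (OrthFlow fld)
open Literature.MathematicalPhysics.QuantumFieldTheory.Balaban1983to89.B4Reflection242 (blk boxDom mem_boxDom blk_mul)
open Literature.MathematicalPhysics.QuantumFieldTheory.Balaban1983to89.B4Lower18 (fineDom mem_fineDom IsBlockUnion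
  fineDom_boxDom boxDom_isBlockUnion edistR)
open Literature.MathematicalPhysics.QuantumFieldTheory.Balaban1983to89.B4Lower18Regular (e1 e1_apply_self e1_apply_ne
  threshold_exists rot_lipschitz)
open Literature.MathematicalPhysics.QuantumFieldTheory.Balaban1983to89.B4Lemma21Region (regionOp regionDeriv siteNorm
  RegularCubeInstance linInst linInst_meets)
open Literature.MathematicalPhysics.QuantumFieldTheory.Balaban1983to89.B4TwoRegion120 (incl)
open Literature.MathematicalPhysics.QuantumFieldTheory.Balaban1983to89.B4Cor23ZeroDelta (outR mem_outR setDist inclEmb)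
open Literature.MathematicalPhysics.QuantumFieldTheory.Balaban1983to89.B4Cor23ZeroEta (weaken_main weaken_delta)
open Literature.MathematicalPhysics.QuantumFieldTheory.Balaban1983to89.B4Cor23Region (bsupp bsuppDist bsuppDist_nonneg
  bl2n c0R delta0R cR c0R_pos delta0R_pos cor23_main_region eq_zero_of_not_mem_bsupp)
open Literature.MathematicalPhysics.QuantumFieldTheory.Balaban1983to89.B4Cor23RegionDeltaAlg (extV resV dGv fineDom_mono)
open Literature.MathematicalPhysics.QuantumFieldTheory.Balaban1983to89.B4Cor23RegionDelta (bdistV c1R two_c0R_le_c1R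
  dcor23_main_region)

noncomputable section

variable {d : ℕ} {ι : Type} [Fintype ι] [DecidableEq ι]

/-! ## §1. The pairings of (2.30) and of the `δG` clause, raw parameters -/

section Raw

variable (F : OrthFlow ι) (a e : ℝ) {n : ℕ} (hn : 1 ≤ n) (m2 : ℝ) {Ωc Ω₀c : Finset (Fin (d + 1) → ℤ)}
  (hΩ : Ωc ⊆ Ω₀c) (Ac : (Fin (d + 1) → ℤ) → Fin (d + 1) → ℝ)

/-- the four pairings of (2.30) for `G = G_k(Ω,A)`, in the printed order `|⟨f,Gf'⟩|, |⟨f,D_μGf'⟩|, |⟨f,GD_ν^*f'⟩|,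
|⟨f,D_μGD_ν^*f'⟩|` (`D^{η*}` = the `ℓ²` adjoint = transpose). [cite: Balaban1983RegularityDecay, (2.30) p. 580] -/
def pairR (Ωc : Finset (Fin (d + 1) → ℤ)) (k : Fin 4) (μ ν : Fin (d + 1)) (f f' : ↥(fineDom n Ωc) × ι → ℝ) : ℝ :=
  if k = 0 then |f ⬝ᵥ ((regionOp F e hn a m2 Ωc Ac)⁻¹ *ᵥ f')|
  else if k = 1 then |f ⬝ᵥ (regionDeriv F e n Ωc Ac μ *ᵥ ((regionOp F e hn a m2 Ωc Ac)⁻¹ *ᵥ f'))|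
  else if k = 2 then |f ⬝ᵥ ((regionOp F e hn a m2 Ωc Ac)⁻¹ *ᵥ ((regionDeriv F e n Ωc Ac ν)ᵀ *ᵥ f'))|
  else |f ⬝ᵥ (regionDeriv F e n Ωc Ac μ *ᵥ ((regionOp F e hn a m2 Ωc Ac)⁻¹ *ᵥ ((regionDeriv F e n Ωc Ac ν)ᵀ *ᵥ f')))|

/-- `δG_k(Ω,Ω₀,A) g = G_k(Ω,A) g − (G_k(Ω₀,A) ext g)|_Ω` (1.11) on configurations on `Ω` (`B4Cor23RegionDeltaAlg.dGv`).
[cite: Balaban1983RegularityDecay, (1.11) p. 573] -/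
def deltaG (g : ↥(fineDom n Ωc) × ι → ℝ) : ↥(fineDom n Ωc) × ι → ℝ :=
  dGv (fineDom_mono hn hΩ) (regionOp F e hn a m2 Ωc Ac)⁻¹ (regionOp F e hn a m2 Ω₀c Ac)⁻¹ g

/-- the four pairings for `δG_k(Ω,Ω₀,A)` in the printed order (the derivatives outside `δG` are those of `Ω`).
[cite: Balaban1983RegularityDecay, (1.11) p. 573 + Cor. 2.3 p. 581] -/
def dpairR (k : Fin 4) (μ ν : Fin (d + 1)) (f f' : ↥(fineDom n Ωc) × ι → ℝ) : ℝ :=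
  if k = 0 then |f ⬝ᵥ deltaG F a e hn m2 hΩ Ac f'|
  else if k = 1 then |f ⬝ᵥ (regionDeriv F e n Ωc Ac μ *ᵥ deltaG F a e hn m2 hΩ Ac f')|
  else if k = 2 then |f ⬝ᵥ deltaG F a e hn m2 hΩ Ac ((regionDeriv F e n Ωc Ac ν)ᵀ *ᵥ f')|
  else |f ⬝ᵥ (regionDeriv F e n Ωc Ac μ *ᵥ deltaG F a e hn m2 hΩ Ac ((regionDeriv F e n Ωc Ac ν)ᵀ *ᵥ f'))|

omit [Fintype ι] [DecidableEq ι] in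
/-- extension by zero along the identity inclusion is the identity. [folklore] -/
theorem extV_refl {R : Finset (Fin (d + 1) → ℤ)} (g : ↥R × ι → ℝ) : extV R g = g := by
  funext j
  unfold extV
  rw [dif_pos j.1.2]

omit [Fintype ι] [DecidableEq ι] in
/-- restriction along the identity inclusion is the identity. [folklore] -/
theorem resV_refl {R : Finset (Fin (d + 1) → ℤ)} (h : R ⊆ R) (U : ↥R × ι → ℝ) : resV h U = U := by
  funext j
  rfl

omit [Fintype ι] [DecidableEq ι] in
/-- the extension of the zero configuration is zero. [folklore] -/
theorem extV_zero {R R₀ : Finset (Fin (d + 1) → ℤ)} : extV R₀ (0 : ↥R × ι → ℝ) = 0 := by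
  funext j
  unfold extV
  split_ifs <;> rfl

omit [Fintype ι] [DecidableEq ι] in
/-- the restriction of the zero configuration is zero. [folklore] -/
theorem resV_zero {R R₀ : Finset (Fin (d + 1) → ℤ)} (h : R ⊆ R₀) : resV h (0 : ↥R₀ × ι → ℝ) = 0 :=
  funext fun _ => rfl

/-- `δG 0 = 0`. [folklore] -/
theorem deltaG_zero : deltaG F a e hn m2 hΩ Ac 0 = 0 := by
  unfold deltaG dGv
  rw [extV_zero, mulVec_zero, mulVec_zero, resV_zero, sub_zero]

/-- `δG_k(Ω,Ω,A) = 0`: for `Ω₀ = Ω` the difference (1.11) vanishes. [folklore] -/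
theorem deltaG_self (hΩ' : Ωc ⊆ Ωc) (g : ↥(fineDom n Ωc) × ι → ℝ) : deltaG F a e hn m2 hΩ' Ac g = 0 := by
  unfold deltaG dGv
  rw [extV_refl, resV_refl, sub_self]

/-- the `δG` pairings vanish for `f = 0`. [folklore] -/
theorem dpairR_eq_zero_left (k : Fin 4) (μ ν : Fin (d + 1)) (f' : ↥(fineDom n Ωc) × ι → ℝ) :
    dpairR F a e hn m2 hΩ Ac k μ ν 0 f' = 0 := by
  unfold dpairR
  simp only [zero_dotProduct, abs_zero]
  split_ifs <;> rfl

/-- the `δG` pairings vanish for `f' = 0`. [folklore] -/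
theorem dpairR_eq_zero_right (k : Fin 4) (μ ν : Fin (d + 1)) (f : ↥(fineDom n Ωc) × ι → ℝ) :
    dpairR F a e hn m2 hΩ Ac k μ ν f 0 = 0 := by
  unfold dpairR
  simp only [mulVec_zero, deltaG_zero, dotProduct_zero, abs_zero]
  split_ifs <;> rfl

/-- the `δG` pairings vanish for `Ω₀ = Ω`. [folklore] -/
theorem dpairR_eq_zero_of_refl (hΩ' : Ωc ⊆ Ωc) (k : Fin 4) (μ ν : Fin (d + 1)) (f f' : ↥(fineDom n Ωc) × ι → ℝ) :
    dpairR F a e hn m2 hΩ' Ac k μ ν f f' = 0 := by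
  unfold dpairR
  simp only [deltaG_self, mulVec_zero, dotProduct_zero, abs_zero]
  split_ifs <;> rfl

omit [Fintype ι] [DecidableEq ι] in
include hn hΩ in
/-- if `Ω₀∖Ω` has no fine point then `Ω₀ = Ω` at the level of unit labels (`n ≥ 1`). [folklore] -/
theorem labels_eq_of_outR_empty (hout : ¬ (outR (fineDom n Ωc) (fineDom n Ω₀c)).Nonempty) : Ω₀c = Ωc := by
  refine Finset.Subset.antisymm (fun y hy => ?_) hΩ
  -- the corner `n·y` of the block `y` is a fine point of `Ω₀`, hence of `Ω`
  have hx : (fun i => (n : ℤ) * y i) ∈ fineDom n Ω₀c := by rw [mem_fineDom hn, blk_mul hn]; exact hy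
  by_contra hyc
  have hx' : (fun i => (n : ℤ) * y i) ∉ fineDom n Ωc := by rw [mem_fineDom hn, blk_mul hn]; exact hyc
  exact hout ⟨⟨_, hx⟩, mem_outR.2 hx'⟩

end Raw

/-! ## §2. The bounds, raw parameters -/

section Bounds

variable (F : OrthFlow ι) {ℓ : ℝ} (hℓ : 0 ≤ ℓ)
  (hLip : ∀ t (v : ι → ℝ), ((F.U t - 1) *ᵥ v) ⬝ᵥ ((F.U t - 1) *ᵥ v) ≤ (ℓ * t) ^ 2 * (v ⬝ᵥ v))
  {e : ℝ} (he : 0 < e) {n : ℕ} (hn : 1 ≤ n) {a : ℝ} (ha : 0 < a) {m2 : ℝ} (hm : 0 ≤ m2)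
  {Ωc Ω₀c : Finset (Fin (d + 1) → ℤ)} (hΩ : Ωc ⊆ Ω₀c) {Ac : (Fin (d + 1) → ℤ) → Fin (d + 1) → ℝ} {c β : ℝ}
  (hc : 0 ≤ c)
  (h17 : ∀ x ∈ fineDom n Ω₀c, ∀ μ ν : Fin (d + 1), |Ac (x + e1 μ) ν - Ac x ν| ≤ c * e ^ (β - 1) / n)
  (hsmall : ℓ ^ 2 * ((d + 1) * c * e ^ β) ^ 2 * (d + 1) * (1 + a * (d + 1)) ≤ min 2 a / 4)

include hℓ hLip he ha hm hΩ hc h17 hsmall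

/-- the `G` pairings: `≤ max(c₀,c₁) e^{−(δ₀/2)D} ‖f‖₂‖f'‖₂` from `B4Cor23Region.cor23_main_region` (rate weakened from
`δ₀` to `δ₀/2`; (1.7) is used on `Ω ⊆ Ω₀` only). [cite: Balaban1983RegularityDecay, Cor. 2.3 (2.30) p. 580] -/
theorem pairR_le (μ ν : Fin (d + 1)) (f f' : ↥(fineDom n Ωc) × ι → ℝ) (k : Fin 4) :
    pairR F a e hn m2 Ac Ωc k μ ν f f' ≤ max (c0R a) (c1R d a)
      * Real.exp (-(delta0R d a / 2 * bsuppDist n (fineDom n Ωc) f f')) * bl2n f * bl2n f' := by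
  have hδ : 0 ≤ delta0R d a := (delta0R_pos d ha).le
  have hD : 0 ≤ bsuppDist n (fineDom n Ωc) f f' := bsuppDist_nonneg f f'
  have hF : 0 ≤ bl2n f := Real.sqrt_nonneg _
  have hG : 0 ≤ bl2n f' := Real.sqrt_nonneg _
  have hc0 : 0 ≤ c0R a := (c0R_pos ha).le
  have h17' : ∀ x ∈ fineDom n Ωc, ∀ μ ν : Fin (d + 1), |Ac (x + e1 μ) ν - Ac x ν| ≤ c * e ^ (β - 1) / n :=
    fun x hx => h17 x (fineDom_mono hn hΩ hx)
  obtain ⟨m0, m1, m2', m3⟩ := cor23_main_region F hℓ hLip he hn ha hm Ωc hc h17' hsmall f f' μ ν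
  unfold pairR
  split_ifs
  · exact weaken_main hδ hD hF hG hc0 m0
  · exact weaken_main hδ hD hF hG hc0 m1
  · exact weaken_main hδ hD hF hG hc0 m2'
  · exact weaken_main hδ hD hF hG hc0 m3

/-- the `δG` pairings vanish in the degenerate cases and obey `B4Cor23RegionDelta.dcor23_main_region` otherwise; hence,
for an admissible pair `b, b'` of boundary distances, all four are
`≤ max(c₀,c₁) e^{−(δ₀/2)D} e^{−(δ₀/2)(b+b')} ‖f‖₂‖f'‖₂`. [cite: Balaban1983RegularityDecay, Cor. 2.3 p. 581 (δG clause)] -/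
theorem dpairR_le (μ ν : Fin (d + 1)) (f f' : ↥(fineDom n Ωc) × ι → ℝ) {b b' : ℝ}
    (hb : (outR (fineDom n Ωc) (fineDom n Ω₀c)).Nonempty → (bsupp f).Nonempty → b ≤ bdistV n (fineDom_mono hn hΩ) f)
    (hb' : (outR (fineDom n Ωc) (fineDom n Ω₀c)).Nonempty → (bsupp f').Nonempty →
      b' ≤ bdistV n (fineDom_mono hn hΩ) f')
    (k : Fin 4) :
    dpairR F a e hn m2 hΩ Ac k μ ν f f' ≤ max (c0R a) (c1R d a)
      * Real.exp (-(delta0R d a / 2 * bsuppDist n (fineDom n Ωc) f f'))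
      * Real.exp (-(delta0R d a / 2 * (b + b'))) * bl2n f * bl2n f' := by
  have hδ : 0 ≤ delta0R d a := (delta0R_pos d ha).le
  have hF : 0 ≤ bl2n f := Real.sqrt_nonneg _
  have hG : 0 ≤ bl2n f' := Real.sqrt_nonneg _
  have hc1 : 0 ≤ c1R d a := by
    have h2 := two_c0R_le_c1R d ha
    have h0 := (c0R_pos ha).le
    linarith
  have hnn : 0 ≤ max (c0R a) (c1R d a) * Real.exp (-(delta0R d a / 2 * bsuppDist n (fineDom n Ωc) f f'))
      * Real.exp (-(delta0R d a / 2 * (b + b'))) * bl2n f * bl2n f' :=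
    mul_nonneg (mul_nonneg (mul_nonneg (mul_nonneg (hc1.trans (le_max_right _ _)) (Real.exp_nonneg _))
      (Real.exp_nonneg _)) hF) hG
  by_cases hout : (outR (fineDom n Ωc) (fineDom n Ω₀c)).Nonempty
  · by_cases hS : (bsupp f).Nonempty
    · by_cases hT : (bsupp f').Nonempty
      · obtain ⟨e0, e1', e2, e3⟩ := dcor23_main_region F hℓ hLip he hn ha hm hΩ hc h17 hsmall f f' μ ν
        have hb0 := hb hout hS
        have hb1 := hb' hout hT
        unfold dpairR deltaG
        split_ifs
        · exact weaken_delta hδ hb0 hb1 hF hG hc1 e0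
        · exact weaken_delta hδ hb0 hb1 hF hG hc1 e1'
        · exact weaken_delta hδ hb0 hb1 hF hG hc1 e2
        · exact weaken_delta hδ hb0 hb1 hF hG hc1 e3
      · -- `f' = 0`
        have hf' : f' = 0 := by
          funext j
          exact eq_zero_of_not_mem_bsupp f' j (fun hj => hT ⟨j.1, hj⟩)
        subst hf'
        rw [dpairR_eq_zero_right]
        exact hnn
    · -- `f = 0`
      have hf : f = 0 := by
        funext j
        exact eq_zero_of_not_mem_bsupp f j (fun hj => hS ⟨j.1, hj⟩)
      subst hf
      rw [dpairR_eq_zero_left]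
      exact hnn
  · -- `Ω₀ = Ω`: `δG = 0`
    have hEq : Ω₀c = Ωc := labels_eq_of_outR_empty hn hΩ hout
    subst hEq
    rw [dpairR_eq_zero_of_refl]
    exact hnn

end Bounds

/-! ## §3. The family of regular-field region pairs and its carrier -/

/-- AN INSTANCE of the Corollary-2.3 family at `A ≠ 0`: a regular-cube instance of `B4Lemma21Region` (scale `n ≥ 1`,
unit labels `Ωc` of `Ω`, charge `e`, vector field `A_ν(x)` in component form, mass `m² ≥ 0`) together with the unit
labels `Ω₀c ⊇ Ωc` of the ambient region `Ω₀ ⊇ Ω` of (1.11); NO further hypothesis (regularity and the big-block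
property are the carrier's antecedents). [cite: Balaban1983RegularityDecay, §1 (1.1)–(1.7), (1.11) pp. 572–573] -/
structure RegularPairInstance (d : ℕ) extends RegularCubeInstance d where
  /-- the unit labels of `Ω₀ ⊇ Ω` -/
  Ω₀c : Finset (Fin (d + 1) → ℤ)
  hsub : Ωc ⊆ Ω₀c

namespace RegularPairInstance

variable (i : RegularPairInstance d) (F : OrthFlow ι) (a : ℝ)

/-- `G_k(Ω,A)` of the instance. [cite: Balaban1983RegularityDecay, p. 572 (1.6)] -/
def green : Matrix (↥(fineDom i.n i.Ωc) × ι) (↥(fineDom i.n i.Ωc) × ι) ℝ :=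
  (regionOp F i.e i.hn a i.m2 i.Ωc i.Ac)⁻¹

/-- `D^η_{A,μ}` of the instance on `Ω`. [cite: Balaban1983RegularityDecay, p. 572 (1.3)] -/
def deriv (μ : Fin (d + 1)) : Matrix (↥(fineDom i.n i.Ωc) × ι) (↥(fineDom i.n i.Ωc) × ι) ℝ :=
  regionDeriv F i.e i.n i.Ωc i.Ac μ

/-- `δG_k(Ω,Ω₀,A)` of the instance. [cite: Balaban1983RegularityDecay, p. 573 (1.11)] -/
def dgreen (g : ↥(fineDom i.n i.Ωc) × ι → ℝ) : ↥(fineDom i.n i.Ωc) × ι → ℝ :=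
  deltaG F a i.e i.hn i.m2 i.hsub i.Ac g

/-- the four pairings (2.30) of the instance. [cite: Balaban1983RegularityDecay, (2.30) p. 580] -/
def pairing (k : Fin 4) (μ ν : Fin (d + 1)) (f f' : ↥(fineDom i.n i.Ωc) × ι → ℝ) : ℝ :=
  pairR F a i.e i.hn i.m2 i.Ac i.Ωc k μ ν f f'

/-- the four `δG` pairings of the instance. [cite: Balaban1983RegularityDecay, (1.11) p. 573 + Cor. 2.3 p. 581] -/
def dpairing (k : Fin 4) (μ ν : Fin (d + 1)) (f f' : ↥(fineDom i.n i.Ωc) × ι → ℝ) : ℝ :=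
  dpairR F a i.e i.hn i.m2 i.hsub i.Ac k μ ν f f'

/-- `‖f‖_∞ = sup_x |f(x)|` (Euclidean site norm; `0` for the empty region) — a DEFINITION ONLY. [folklore] -/
def supN (f : ↥(fineDom i.n i.Ωc) × ι → ℝ) : ℝ :=
  if h : (Finset.univ : Finset ↥(fineDom i.n i.Ωc)).Nonempty then
    Finset.univ.sup' h (fun x => siteNorm (fld f x)) else 0

end RegularPairInstance

open RegularPairInstance

/-- **THE CONCRETE REGULAR-FIELD CARRIER** of instance `i` (family parameters: the flow `F`, the constant `a` of
`aP_k`, the constants `c, β` of (1.7), the big-block size `M`, and a boundary-distance assignment `g`, `g i f` playing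
`dist(supp f, Ω^c)`): the fields of `B4.EtaSetting` filled on the fine points of `Ω` — `pair`/`dpair` = (2.30) and its
`δG` version for `G_k(Ω,A)`, `δG_k(Ω,Ω₀,A)`; `regular` = (1.7) in lattice units ON `Ω₀`, `|A_ν(x + e_μ) − A_ν(x)| ≤
c e^{β−1}/n` for `x ∈ Ω₀`; `bigBlocks` = `Ω`, `Ω₀` are unions of `M`-blocks («We consider subsets Ω which are unions
of big blocks.»); `e = i.e`; `ssdist`, `l2Norm`, `bdistS` as read by `Cor23Printed`; the (1.9)-quotients `lhs19`,
`dlhs19` are NOT MODELLED (`0`; `ThmPrinted` must not be read on this carrier); the remaining fields are definitions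
only (see the module docstring). [cite: Balaban1983RegularityDecay, §1 pp. 572–573 + Cor. 2.3 pp. 580–581] -/
def regularPairSettingB (F : OrthFlow ι) (a c β : ℝ) (M : ℕ)
    (g : ∀ i : RegularPairInstance d, (↥(fineDom i.n i.Ωc) × ι → ℝ) → ℝ) (i : RegularPairInstance d) :
    EtaSetting where
  Site := ↥(fineDom i.n i.Ωc)
  Dir := Fin (d + 1)
  Src := ↥(fineDom i.n i.Ωc) × ι → ℝ
  e := i.e
  regular := ∀ x ∈ fineDom i.n i.Ω₀c, ∀ μ ν : Fin (d + 1), |i.Ac (x + e1 μ) ν - i.Ac x ν| ≤ c * i.e ^ (β - 1) / i.n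
  bigBlocks := IsBlockUnion (M * i.n) (fineDom i.n i.Ωc) ∧ IsBlockUnion (M * i.n) (fineDom i.n i.Ω₀c)
  rect := ∃ l u : Fin (d + 1) → ℤ, ∀ x : Fin (d + 1) → ℤ, x ∈ fineDom i.n i.Ωc ↔ ∀ j, l j ≤ x j ∧ x j ≤ u j
  pdist := fun x y => edistR i.n (fineDom i.n i.Ωc) x y
  sdist1 := fun x f => setDist (edistR i.n (fineDom i.n i.Ωc)) {x} (bsupp f)
  sdist2 := fun x x' f => setDist (edistR i.n (fineDom i.n i.Ωc)) ({x} ∪ {x'}) (bsupp f)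
  bdist1 := fun x => setDist (edistR i.n (fineDom i.n i.Ω₀c)) {incl (fineDom_mono i.hn i.hsub) x}
    (outR (fineDom i.n i.Ωc) (fineDom i.n i.Ω₀c))
  bdist2 := fun x x' => setDist (edistR i.n (fineDom i.n i.Ω₀c))
    ({incl (fineDom_mono i.hn i.hsub) x} ∪ {incl (fineDom_mono i.hn i.hsub) x'}) (outR (fineDom i.n i.Ωc) (fineDom i.n i.Ω₀c))
  bdistS := fun f => g i f
  supNorm := fun f => i.supN f
  l2Norm := fun f => bl2n f
  ssdist := fun f f' => bsuppDist i.n (fineDom i.n i.Ωc) f f'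
  lhs19 := fun _ _ _ _ _ => 0
  valDG := fun μ f x => siteNorm (fld (i.deriv F μ *ᵥ (i.green F a *ᵥ f)) x)
  valG := fun f x => siteNorm (fld (i.green F a *ᵥ f) x)
  dlhs19 := fun _ _ _ _ _ => 0
  dvalDG := fun μ f x => siteNorm (fld (i.deriv F μ *ᵥ i.dgreen F a f) x)
  dvalG := fun f x => siteNorm (fld (i.dgreen F a f) x)
  lower18 := fun γ => ∀ v : ↥(fineDom i.n i.Ωc) × ι → ℝ, γ * (v ⬝ᵥ v) ≤ v ⬝ᵥ (regionOp F i.e i.hn a 0 i.Ωc i.Ac *ᵥ v)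
  pair := fun k μ ν f f' => i.pairing F a k μ ν f f'
  dpair := fun k μ ν f f' => i.dpairing F a k μ ν f f'

/-! An assignment `g i f` of "the distance from `supp f` to `Ω^c`" is called ADMISSIBLE below if, whenever `Ω₀∖Ω`
and `supp f` are nonempty, it does not exceed the η-distance from `supp f` to the fine points of `Ω₀∖Ω`
(`B4Cor23RegionDelta.bdistV`): the hypothesis of `cor23Printed_regularPairB`.  The printed `dist(supp f, Ω^c)`
(complement in the ambient η-lattice) is admissible because `Ω₀∖Ω ⊆ Ω^c`; so is `bdistV` itself (the default carrier
`regularPairSetting`). -/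

/-- the default carrier: `bdistS f = dist_η(supp f, Ω₀∖Ω)` (`B4Cor23RegionDelta.bdistV`).
[cite: Balaban1983RegularityDecay, §1 pp. 572–573 + Cor. 2.3 pp. 580–581] -/
def regularPairSetting (F : OrthFlow ι) (a c β : ℝ) (M : ℕ) : RegularPairInstance d → EtaSetting :=
  regularPairSettingB F a c β M fun i f => bdistV i.n (fineDom_mono i.hn i.hsub) f

/-- the typed «let A be as in the theorem» antecedent of instance `i` is the printed regularity (1.7) in lattice units,
on the ambient region `Ω₀`. [cite: Balaban1983RegularityDecay, p. 573 (1.7)] -/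
theorem regular_iff (F : OrthFlow ι) (a c β : ℝ) (M : ℕ)
    (g : ∀ i : RegularPairInstance d, (↥(fineDom i.n i.Ωc) × ι → ℝ) → ℝ) (i : RegularPairInstance d) :
    (regularPairSettingB F a c β M g i).regular ↔
      ∀ x ∈ fineDom i.n i.Ω₀c, ∀ μ ν : Fin (d + 1), |i.Ac (x + e1 μ) ν - i.Ac x ν| ≤ c * i.e ^ (β - 1) / i.n :=
  Iff.rfl

/-- the typed big-block antecedent of instance `i` reads: `Ω` and `Ω₀` are unions of `M`-blocks. [folklore] -/
theorem bigBlocks_iff (F : OrthFlow ι) (a c β : ℝ) (M : ℕ)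
    (g : ∀ i : RegularPairInstance d, (↥(fineDom i.n i.Ωc) × ι → ℝ) → ℝ) (i : RegularPairInstance d) :
    (regularPairSettingB F a c β M g i).bigBlocks ↔
      IsBlockUnion (M * i.n) (fineDom i.n i.Ωc) ∧ IsBlockUnion (M * i.n) (fineDom i.n i.Ω₀c) := Iff.rfl

/-! ## §4. Corollary 2.3 typed on the family -/

/-- **B4 COROLLARY 2.3 AT `A ≠ 0`, IN THE TYPED FORM `B4.Cor23Printed`**: for every `d`, every orthogonal flow with
`‖(U(t) − 1)v‖² ≤ (ℓt)²‖v‖²`, every `a > 0`, `c ≥ 0`, `β > 0`, every big-block size `M` (the antecedent «unions of big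
blocks» is carried, not used) and every ADMISSIBLE boundary-distance assignment `g` (in particular the printed
`dist(supp f, Ω^c)` and `bdistV`), the family of ALL regular-field region pairs (every mesh `η = 1/n`, every nested pair
`Ω ⊆ Ω₀` of finite unions of unit blocks, every mass `m² ≥ 0`, every charge, every vector field) satisfies
`Cor23Printed` with the witnesses `c₀ = max(c0R a, c1R d a)`, `δ₀ = delta0R d a / 2` and the threshold `e₁` of
`B4Lower18Regular.threshold_exists` — «there exist positive constants c₀, δ₀ such that for arbitrary … f, f' defined
on Ω, we have» (2.30) «The same inequalities hold for δG_k(Ω,Ω₀,A) with the additional factor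
e^{−δ₀(dist(supp f,Ω^c) + dist(supp f',Ω^c))}.» for «e sufficiently small» and `A` regular (1.7) (on `Ω₀`) — from
`cor23_main_region` and `dcor23_main_region`. [cite: Balaban1983RegularityDecay, Cor. 2.3 (2.30) pp. 580–581; (1.7) p. 573] -/
theorem cor23Printed_regularPairB (F : OrthFlow ι) {ℓ : ℝ} (hℓ : 0 ≤ ℓ)
    (hLip : ∀ t (v : ι → ℝ), ((F.U t - 1) *ᵥ v) ⬝ᵥ ((F.U t - 1) *ᵥ v) ≤ (ℓ * t) ^ 2 * (v ⬝ᵥ v))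
    {a : ℝ} (ha : 0 < a) {c : ℝ} (hc : 0 ≤ c) {β : ℝ} (hβ : 0 < β) (M : ℕ)
    (g : ∀ i : RegularPairInstance d, (↥(fineDom i.n i.Ωc) × ι → ℝ) → ℝ)
    (hg : ∀ (i : RegularPairInstance d) (f : ↥(fineDom i.n i.Ωc) × ι → ℝ),
      (outR (fineDom i.n i.Ωc) (fineDom i.n i.Ω₀c)).Nonempty → (bsupp f).Nonempty →
        g i f ≤ bdistV i.n (fineDom_mono i.hn i.hsub) f) :
    Cor23Printed (regularPairSettingB (d := d) F a c β M g) := by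
  obtain ⟨e₁, he₁, hsm⟩ := threshold_exists ℓ ((d + 1) * c) ha hβ d
  refine ⟨max (c0R a) (c1R d a), delta0R d a / 2, e₁, lt_max_of_lt_left (c0R_pos ha),
    half_pos (delta0R_pos d ha), he₁, ?_⟩
  intro i hreg _ he hle k μ ν f f'
  change 0 < i.e at he
  change i.e ≤ e₁ at hle
  rw [regular_iff] at hreg
  have hsm' : ℓ ^ 2 * ((d + 1) * c * i.e ^ β) ^ 2 * (d + 1) * (1 + a * (d + 1)) ≤ min 2 a / 4 := by
    have := hsm i.e he hle
    simpa only [mul_assoc] using this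
  exact ⟨pairR_le F hℓ hLip he i.hn ha i.hm i.hsub hc hreg hsm' μ ν f f' k,
    dpairR_le F hℓ hLip he i.hn ha i.hm i.hsub hc hreg hsm' μ ν f f' (hg i f) (hg i f') k⟩

/-- **B4 COROLLARY 2.3 AT `A ≠ 0`** for the default carrier (`bdistS = dist_η(supp ·, Ω₀∖Ω)`).
[cite: Balaban1983RegularityDecay, Cor. 2.3 (2.30) pp. 580–581] -/
theorem cor23Printed_regularPair (F : OrthFlow ι) {ℓ : ℝ} (hℓ : 0 ≤ ℓ)
    (hLip : ∀ t (v : ι → ℝ), ((F.U t - 1) *ᵥ v) ⬝ᵥ ((F.U t - 1) *ᵥ v) ≤ (ℓ * t) ^ 2 * (v ⬝ᵥ v))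
    {a : ℝ} (ha : 0 < a) {c : ℝ} (hc : 0 ≤ c) {β : ℝ} (hβ : 0 < β) (M : ℕ) :
    Cor23Printed (regularPairSetting (d := d) F a c β M) :=
  cor23Printed_regularPairB F hℓ hLip ha hc hβ M _ fun _ _ _ _ => le_rfl

/-- Corollary 2.3 typed on the regular-field family for the ROTATION FLOW (`N = 2`, `ℓ = 1`): a hypothesis-free
instance of the flow assumptions. [cite: Balaban1983RegularityDecay, Cor. 2.3 (2.30) pp. 580–581] -/
theorem cor23Printed_regularPair_rot {a : ℝ} (ha : 0 < a) {c : ℝ} (hc : 0 ≤ c) {β : ℝ} (hβ : 0 < β) (M : ℕ) :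
    Cor23Printed (regularPairSetting (d := d) OrthFlow.rot a c β M) :=
  cor23Printed_regularPair OrthFlow.rot zero_le_one rot_lipschitz ha hc hβ M

/-! ## §5. Non-vacuity: the antecedents are met below every threshold, by non-constant fields on nested pairs -/

/-- THE LINEAR-FIELD PAIR INSTANCE: mesh `1/n`, `Ω` = the fine region over the large block `[0,M)^{d+1}` of unit
labels, `Ω₀` = the fine region over `[0,2M)^{d+1}`, mass `m²`, charge `e`, and the NON-CONSTANT vector field
`A_ν(x) = λ·x_0` (`B4Lemma21Region.linInst` with an ambient region). [folklore] -/
def linPairInst (d : ℕ) {n : ℕ} (hn : 1 ≤ n) (M : ℕ) {m2 : ℝ} (hm : 0 ≤ m2) (lam e : ℝ) : RegularPairInstance d where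
  toRegularCubeInstance := linInst d hn M hm lam e
  Ω₀c := boxDom fun _ => 2 * M
  hsub := by
    intro x hx
    change x ∈ boxDom fun _ : Fin (d + 1) => M at hx
    rw [mem_boxDom] at hx ⊢
    intro j
    refine ⟨(hx j).1, (hx j).2.trans_le ?_⟩
    push_cast
    linarith [(Nat.cast_nonneg M : (0 : ℤ) ≤ M)]

/-- **NON-VACUITY OF THE TYPED COROLLARY AT `A ≠ 0`**: for EVERY threshold `e₁ > 0`, every `M ≥ 1`, every mesh and
every mass, the linear-field pair instance with charge `e₁` and slope `λ = c e₁^{β−1}/n` meets every antecedent of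
`Cor23Printed` on the carrier — regular (1.7) on `Ω₀` with constant `c`, `bigBlocks`, `0 < e ≤ e₁` — and is
non-degenerate: `Ω₀∖Ω` has fine points (so the `δG` clause and the admissibility condition are exercised) and `Ω` is
nonempty.  So the threshold of `cor23Printed_regularPairB` excludes no scale, region size or mass, and the conclusion
is asserted for genuinely non-zero fields. [folklore] -/
theorem linPairInst_meets (F : OrthFlow ι) (a : ℝ) {c : ℝ} (hc : 0 ≤ c) (β : ℝ) {M : ℕ} (hM : 1 ≤ M) {n : ℕ}
    (hn : 1 ≤ n) {m2 : ℝ} (hm : 0 ≤ m2) {e₁ : ℝ} (he₁ : 0 < e₁)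
    (g : ∀ i : RegularPairInstance d, (↥(fineDom i.n i.Ωc) × ι → ℝ) → ℝ) :
    (regularPairSettingB F a c β M g (linPairInst d hn M hm (c * e₁ ^ (β - 1) / n) e₁)).regular ∧
      (regularPairSettingB F a c β M g (linPairInst d hn M hm (c * e₁ ^ (β - 1) / n) e₁)).bigBlocks ∧
      0 < (regularPairSettingB F a c β M g (linPairInst d hn M hm (c * e₁ ^ (β - 1) / n) e₁)).e ∧
      (regularPairSettingB F a c β M g (linPairInst d hn M hm (c * e₁ ^ (β - 1) / n) e₁)).e ≤ e₁ ∧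
      (outR (fineDom n (boxDom fun _ : Fin (d + 1) => M)) (fineDom n (boxDom fun _ : Fin (d + 1) => 2 * M))).Nonempty ∧
      (fineDom n (boxDom fun _ : Fin (d + 1) => M)).Nonempty := by
  have hMn : 1 ≤ M * n := Nat.succ_le_of_lt (Nat.mul_pos hM hn)
  have hnM : (1 : ℤ) ≤ (n : ℤ) * (M : ℤ) := by exact_mod_cast (show 1 ≤ n * M by nlinarith)
  refine ⟨?_, ⟨?_, ?_⟩, he₁, le_rfl, ?_, ?_⟩
  · -- (1.7) on `Ω₀` for `A_ν(x) = λ x_0`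
    intro x _ μ ν
    show |c * e₁ ^ (β - 1) / n * (((x + e1 μ) 0 : ℤ) : ℝ) - c * e₁ ^ (β - 1) / n * ((x 0 : ℤ) : ℝ)|
      ≤ c * e₁ ^ (β - 1) / n
    have hlam : 0 ≤ c * e₁ ^ (β - 1) / n := by positivity
    rw [← mul_sub, abs_mul, abs_of_nonneg hlam]
    apply mul_le_of_le_one_right hlam
    simp only [Pi.add_apply, Int.cast_add, add_sub_cancel_left]
    by_cases h : (0 : Fin (d + 1)) = μ
    · subst h; rw [e1_apply_self]; simp
    · rw [e1_apply_ne h]; simp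
  · show IsBlockUnion (M * n) (fineDom n (boxDom fun _ : Fin (d + 1) => M))
    rw [fineDom_boxDom hn]
    have hfun : (fun _ : Fin (d + 1) => n * M) = fun _ => M * n * 1 := funext fun _ => by ring
    rw [hfun]
    exact boxDom_isBlockUnion hMn fun _ => 1
  · show IsBlockUnion (M * n) (fineDom n (boxDom fun _ : Fin (d + 1) => 2 * M))
    rw [fineDom_boxDom hn]
    have hfun : (fun _ : Fin (d + 1) => n * (2 * M)) = fun _ => M * n * 2 := funext fun _ => by ring
    rw [hfun]
    exact boxDom_isBlockUnion hMn fun _ => 2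
  · -- the corner `(nM,…,nM)` lies in `Ω₀` but not in `Ω`
    have hx : (fun _ : Fin (d + 1) => ((n : ℤ) * (M : ℤ))) ∈ fineDom n (boxDom fun _ : Fin (d + 1) => 2 * M) := by
      rw [fineDom_boxDom hn, mem_boxDom]; intro j
      refine ⟨by positivity, ?_⟩
      push_cast; nlinarith [hnM]
    have hx' : (fun _ : Fin (d + 1) => ((n : ℤ) * (M : ℤ))) ∉ fineDom n (boxDom fun _ : Fin (d + 1) => M) := by
      rw [fineDom_boxDom hn, mem_boxDom]; intro h
      have := (h 0).2; push_cast at this; linarith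
    exact ⟨⟨_, hx⟩, mem_outR.2 hx'⟩
  · refine ⟨fun _ => 0, ?_⟩
    rw [fineDom_boxDom hn, mem_boxDom]; intro j
    refine ⟨le_rfl, ?_⟩
    push_cast; nlinarith [hnM]

/-- hence the typed threshold of `Cor23Printed` is met inside EVERY `e₁ > 0` by a non-degenerate instance of the family
meeting the other antecedents too (any `M ≥ 1`; here mesh `1`, mass `0`). [folklore] -/
theorem threshold_met (F : OrthFlow ι) (a : ℝ) {c : ℝ} (hc : 0 ≤ c) (β : ℝ) {M : ℕ} (hM : 1 ≤ M)
    (g : ∀ i : RegularPairInstance d, (↥(fineDom i.n i.Ωc) × ι → ℝ) → ℝ) {e₁ : ℝ} (he₁ : 0 < e₁) :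
    ∃ i : RegularPairInstance d, (regularPairSettingB F a c β M g i).regular ∧
      (regularPairSettingB F a c β M g i).bigBlocks ∧ 0 < (regularPairSettingB F a c β M g i).e ∧
      (regularPairSettingB F a c β M g i).e ≤ e₁ ∧ (outR (fineDom i.n i.Ωc) (fineDom i.n i.Ω₀c)).Nonempty ∧
      (fineDom i.n i.Ωc).Nonempty := by
  obtain ⟨h1, h2, h3, h4, h5, h6⟩ :=
    linPairInst_meets (d := d) F a hc β hM (n := 1) le_rfl (m2 := 0) le_rfl he₁ g
  exact ⟨linPairInst d (n := 1) le_rfl M (m2 := 0) le_rfl (c * e₁ ^ (β - 1) / (1 : ℕ)) e₁, h1, h2, h3, h4, h5, h6⟩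

/-- Reading the witnesses back: for `d + 1 = 4`, `a = 1` the family constant pair is
`(max(c0R 1, c1R 3 1), delta0R 3 1 / 2) = (c1R 3 1, 1/160)` with `c0R 1 = 340`. [folklore] -/
example : delta0R 3 1 / 2 = 1 / 160 ∧ c0R 1 = 340 := by
  refine ⟨?_, ?_⟩
  · unfold delta0R; rw [min_eq_right (by norm_num : (1:ℝ) ≤ 2)]; norm_num
  · unfold c0R cR; rw [min_eq_right (by norm_num : (1:ℝ) ≤ 2)]; norm_num

end

end Literature.MathematicalPhysics.QuantumFieldTheory.Balaban1983to89.B4Cor23RegionEta
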